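import Summits.ResolutionOfSingularities.ResolutionOfSingularities.Theorems.StallVertexKernels
import HarnessLib

/-!
# StallVertexWalk — decomp-res node «StallVertex» (lens-5 g20), tree file 3/5 of the node

Content VERBATIM from the decomp-res lens-5 g20 file
`HOME/decomp-res-lens-5/g20/parts/StallVertex-g20-0349e14d.lean` (sha256 0349e14dd83eb816, 869 l;
the CLEARED pin — the lens's later rev 1 d60a69dd «stall rigidity» is a superset awaiting its own critic row;
HOME = run/shared/lean/pub/decomp-res).
Critic: CRITIC-LEDGER row 142 (CLEARED 2026-08-30T20:41:19Z, DECIDED +1: the STALL VERTEX LAW `stall_vertex` in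
kernel, hypothesis-free).  Split per the
critic's order (§1–§2 halved for the 400-line limit; the three BY-NAME theorems on
`MaxContactCut.DefectWalksDeep` moved to the wiring file).  Landed by
decomp-res writer g7 in the lens's namespace `…Theorems.StallVertex`; every file of the node is in the Theses cone
(the lens imports the in-cone
`DifferentialShade` for `ifp` / `muTilde`), so the located residual `NoVertexBoundSkewStalledTailsDeep` cannot be
imported by the route file: it is
booked by RE-LOCATING the existing aside 28122 `CFNoSkewJointTailsDeep` (EXACTLY ⟺ it, hypothesis-free:
`skew_iff_vertexBound`) — one aside, not two.

§3 `Walk` (l. 564–658): `sing_ifp`, `VertexLawAt` / `OriginLawAt` / `OffConeAt`, the `_of_stall` theorems along a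
forced walk.  PROVED, 0 sorry.

[WRITER NOTE (decomp-res writer g7): file split only; namespace, opens, section variables and every declaration
exactly as in the lens (global `set_option` dropped).]

(Sources: KawanoueMatsuki2016 §4.1; Hauser2010; HauserPerlega2024; Moh1987; CossartPiltant2008; Giraud1975; Hironaka1964.)
-/

noncomputable section

open MvPolynomial Finset
open Literature.AlgebraicGeometry.Resolution
open Literature.AlgebraicGeometry.Resolution.Hauser2010
open Literature.AlgebraicGeometry.Resolution.HauserPerlega2024
open Literature.Barriers.ResolutionOfSingularities
open Literature.AlgebraicGeometry.Resolution.PointBlowup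
open Summit.ResolutionOfSingularities.ResolutionOfSingularities.Theses
open Summit.ResolutionOfSingularities.ResolutionOfSingularities.Theorems.TightDefectClasses
open Summit.ResolutionOfSingularities.ResolutionOfSingularities.Theorems.ProximityCut
open Summit.ResolutionOfSingularities.ResolutionOfSingularities.Theorems.ExitLaw
open Summit.ResolutionOfSingularities.ResolutionOfSingularities.Theorems.DifferentialShade

namespace Summit.ResolutionOfSingularities.ResolutionOfSingularities.Theorems.StallVertex

/-! ## §3 Along forced walks from a root: the law holds at every stall; classes; the EXACT node -/

section Walk

variable {K : Type} [Field K] [DecidableEq K]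

/-- The `Sing` invariant along a forced walk from a root: every non-zero transported generator `(ifp W t).gen J` has
order at least its level `q − |J|` (Giraud's lemma in the chart, as inside the tree's
`IFPState.muTilde_succ_le_along`). (Sources: KawanoueMatsuki2016, Proposition 4 (2); Giraud1975.) -/
theorem sing_ifp {p e : ℕ} (hp : p.Prime) [CharP K p] {s₀ : State (Fin 3) K} (hs : IsRoot (p ^ e) s₀)
    (W : ForcedWalk (p ^ e) s₀) (t : ℕ) :
    ∀ J ∈ (ifp W t).idx, (ifp W t).gen J ≠ 0 → (((p ^ e - J.degree : ℕ) : ℕ∞)) ≤ ordZero ((ifp W t).gen J) := by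
  haveI : Fact p.Prime := ⟨hp⟩
  have h0 : (W.st 0).F = s₀.F := by rw [W.st_zero]
  have hinv : ∀ n, ((p ^ e : ℕ) : ℕ∞) ≤ ordZero (W.st n).F ∧
      ∀ J ∈ (ifp W n).idx, (ifp W n).gen J ∈
        Ideal.span ((fun M => Literature.AlgebraicGeometry.Resolution.hasseDeriv K M (W.st n).F) ''
          {M | 0 < M.degree ∧ M.degree ≤ J.degree}) := by
    intro n
    induction n with
    | zero =>
      refine ⟨by rw [h0]; exact hs.2.2, ?_⟩
      rw [ifp_zero, h0]
      exact IFPState.gen_init_mem_span (p ^ e) s₀.F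
    | succ n ih =>
      refine ⟨?_, ?_⟩
      · rw [W.st_succ]; exact le_ordZero_step_of_isEquimultiplePoint _ _ _ _ (W.equimult n)
      · rw [W.st_succ, ifp_succ]
        exact IFPState.gen_step_mem_span p e (W.j n) (W.b n) (W.st n) (ifp W n) (level_bounds W n) ih.1 ih.2
  exact IFPState.level_le_ordZero_gen_of_mem_span (p ^ e) (ifp W t) (hinv t).1 (hinv t).2

variable {q : ℕ} {s₀ : State (Fin 3) K}

/-- **THE VERTEX LAW AT TIME `t`** (a kernel predicate on the walk): for every minimising index `J₀` of `μ_P` at the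
transported corner state `ifp W t` (order `d₀`, level `a₀`), the move `(W.j t, W.b t)` satisfies
`d₀ − a₀ · lostMass ≤ mult_{direction} in(g₀)`. -/
def VertexLawAt (W : ForcedWalk q s₀) (t : ℕ) : Prop :=
  ∀ J₀ ∈ (ifp W t).idx, (ifp W t).muP q = levelRatio (ordZero ((ifp W t).gen J₀)) (q - J₀.degree) →
    ∀ d₀ : ℕ, ordZero ((ifp W t).gen J₀) = d₀ →
    (d₀ : ℚ) - (q - J₀.degree : ℕ) * lostMass q (W.j t) (W.b t) (ifp W t) ≤
      ((ordZero (dirForm d₀ (W.j t) (W.b t) ((ifp W t).gen J₀))).toNat : ℚ)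

/-- **THE ORIGIN LAW AT TIME `t`**: if the move is untranslated (`W.b t = 0`), every monomial of the initial form of
every minimiser has `u_{W.j t}`-exponent exactly `a₀ · [W.j t young] · μ_{P,D_{W.j t}}`. -/
def OriginLawAt (W : ForcedWalk q s₀) (t : ℕ) : Prop :=
  (∀ i, W.b t i = 0) → ∀ J₀ ∈ (ifp W t).idx,
    (ifp W t).muP q = levelRatio (ordZero ((ifp W t).gen J₀)) (q - J₀.degree) →
    ∀ d₀ : ℕ, ordZero ((ifp W t).gen J₀) = d₀ → ∀ e ∈ (homogeneousComponent d₀ ((ifp W t).gen J₀)).support,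
    ((e (W.j t) : ℚ) ≤ (q - J₀.degree : ℕ) *
        (if W.j t ∈ (ifp W t).young then ((ifp W t).muPD q (W.j t)).untopD 0 else 0)) ∧
      ((q - J₀.degree : ℕ) * ((ifp W t).muPD q (W.j t)).untopD 0 ≤ (e (W.j t) : ℚ))

/-- **AN OFF-CONE MOVE AT TIME `t`**: the direction of the move avoids the tangent cone of SOME minimiser's initial
form (`ord₀ dirForm = 0`: the direction form has a constant term). Kernel-decidable on census data. -/
def OffConeAt (W : ForcedWalk q s₀) (t : ℕ) : Prop :=
  ∃ J₀ ∈ (ifp W t).idx, (ifp W t).muP q = levelRatio (ordZero ((ifp W t).gen J₀)) (q - J₀.degree) ∧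
    ∃ d₀ : ℕ, ordZero ((ifp W t).gen J₀) = d₀ ∧ ordZero (dirForm d₀ (W.j t) (W.b t) ((ifp W t).gen J₀)) = 0

/-- The vertex law holds at every stalled move of a forced walk from a root (hypothesis-free). [folklore] -/
theorem vertexLawAt_of_stall {p e : ℕ} (hp : p.Prime) [CharP K p] {s₀ : State (Fin 3) K} (hs : IsRoot (p ^ e) s₀)
    (W : ForcedWalk (p ^ e) s₀) (t : ℕ) (hst : (ifp W t).muTilde (p ^ e) ≤ (ifp W (t + 1)).muTilde (p ^ e)) :
    VertexLawAt W t :=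
  fun _ hJ₀ hμ _ hd₀ => stall_vertex (p ^ e) (W.j t) (W.b t) (W.onExc t) (ifp W t)
    (fun J hJ => (level_bounds W t J hJ).2) (sing_ifp hp hs W t) (by rw [← ifp_succ]; exact hst) hJ₀ hμ hd₀

/-- The origin law holds at every untranslated stalled move of a forced walk from a root (hypothesis-free). [folklore] -/
theorem originLawAt_of_stall {p e : ℕ} (hp : p.Prime) [CharP K p] {s₀ : State (Fin 3) K} (hs : IsRoot (p ^ e) s₀)
    (W : ForcedWalk (p ^ e) s₀) (t : ℕ) (hst : (ifp W t).muTilde (p ^ e) ≤ (ifp W (t + 1)).muTilde (p ^ e)) :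
    OriginLawAt W t :=
  fun hb _ hJ₀ hμ _ hd₀ _ he => stall_vertex_origin (p ^ e) (W.j t) (W.b t) hb (ifp W t)
    (fun J hJ => (level_bounds W t J hJ).2) (sing_ifp hp hs W t) (by rw [← ifp_succ]; exact hst) hJ₀ hμ hd₀ he

/-- No off-cone move at a stall with `μ̃ > 0` (hypothesis-free along root walks). [folklore] -/
theorem not_offConeAt_of_stall_pos {p e : ℕ} (hp : p.Prime) [CharP K p] {s₀ : State (Fin 3) K}
    (hs : IsRoot (p ^ e) s₀) (W : ForcedWalk (p ^ e) s₀) (t : ℕ)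
    (hst : (ifp W t).muTilde (p ^ e) ≤ (ifp W (t + 1)).muTilde (p ^ e))
    (hpos : (0 : WithTop ℚ) < (ifp W t).muTilde (p ^ e)) : ¬ OffConeAt W t := by
  rintro ⟨J₀, hJ₀, hμ, d₀, hd₀, h0⟩
  exact ordZero_dirForm_ne_zero_of_stall_pos (p ^ e) (W.j t) (W.b t) (W.onExc t) (ifp W t)
    (fun J hJ => (level_bounds W t J hJ).2) (sing_ifp hp hs W t) (by rw [← ifp_succ]; exact hst) hpos hJ₀ hμ hd₀ h0

/-- **THE WALK FOLLOWS THE TANGENT CONES** (the weak form of the law, hypothesis-free along root walks): at a stalled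
move with positive differential shade, the blown-up direction `[W.b t ; 1_{W.j t}] ∈ ℙ²` is a ZERO OF THE INITIAL FORM
OF EVERY `μ_P`-MINIMISER of the unit. [new] [folklore] -/
theorem eval_direction_initialForm_eq_zero {p e : ℕ} (hp : p.Prime) [CharP K p] {s₀ : State (Fin 3) K}
    (hs : IsRoot (p ^ e) s₀) (W : ForcedWalk (p ^ e) s₀) (t : ℕ)
    (hst : (ifp W t).muTilde (p ^ e) ≤ (ifp W (t + 1)).muTilde (p ^ e))
    (hpos : (0 : WithTop ℚ) < (ifp W t).muTilde (p ^ e))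
    {J₀ : Fin 3 →₀ ℕ} (hJ₀ : J₀ ∈ (ifp W t).idx)
    (hμ : (ifp W t).muP (p ^ e) = levelRatio (ordZero ((ifp W t).gen J₀)) (p ^ e - J₀.degree))
    {d₀ : ℕ} (hd₀ : ordZero ((ifp W t).gen J₀) = d₀) :
    eval (Function.update (W.b t) (W.j t) 1) (homogeneousComponent d₀ ((ifp W t).gen J₀)) = 0 := by
  by_contra h
  exact not_offConeAt_of_stall_pos hp hs W t hst hpos
    ⟨J₀, hJ₀, hμ, d₀, hd₀, (ordZero_dirForm_eq_zero_iff d₀ (W.j t) (W.b t) _).mpr h⟩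

end Walk

end Summit.ResolutionOfSingularities.ResolutionOfSingularities.Theorems.StallVertex
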